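import Literature.NumberTheory.EllipticCurves.FouquetWan2021.KatoMainConjecturePPartOPEN
import Summits.BirchSwinnertonDyer.Rank1Residual.Supersingular.KobayashiConverseReal
import HarnessLib

/-!
# Route `SignedLowerHalves`, crux `KobayashiLowerHalfLargeImage` (item stmt-BirchSwinnertonDyer-19001): the
# registered stub `stub_fwLocus` in ANALYTIC RANK 0, CLOSED MODULO the OPEN binder Fouquet–Wan Cor. 5.4
# (cell `bsd-ssimc`, seat `bsd-ssimc-lev` gen 5, order W-lev-9; a `--supports` helper, closes nothing)

PARTITION (cell bsd-ssimc): X7 (A7) r0 × the Fouquet–Wan locus (87 of the 233 open rank-0 X7 pairs of the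
cell window, all of surjective image) — types-the-object-of; closes NONE. THEOREMS ONLY.

The planner's BC3 skeleton of crux 3 (`Cruxes/KobayashiLowerHalfLargeImage/Lines/birth.lean`, stubs
registered 2026-08-25T23:23Z) splits the crux along the ONE engine claimed in a preprint at
non-square-free level: `stub_fwLocus` = corner X7, `a_p = 0`, `ρ̄_{E,p}` onto, AND a prime `ℓ ≠ p` of
NON-SPLIT multiplicative reduction with `p ∤ ord_ℓ(Δ_min)` ⇒ `∃ ε, KobayashiLowerDivisibility W p ε`;
in print: Fouquet–Wan arXiv:2107.13726 Thm 5.1 / Cor 5.4 (PRE; the seat's audit MEMO-5 + addA/addB)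
+ Kobayashi 2003 Thm 7.4. The Literature file `FouquetWan2021/KatoMainConjecturePPartOPEN.lean`
(p412876) transcribes Cor 5.4 for an elliptic curve at an odd good supersingular prime as the OPEN binder
`cor54_pPart_rankZero_OPEN` and derives `BSD(E,p)` on the locus in rank 0 from it and PUBLISHED facts.
This file composes that with the cell b2b-bsdres's rank-zero converse on the real ± objects
(`kobayashiMainConjecture_of_bsdp_of_analyticRank_eq_zero`, KobayashiConverseReal.lean: `BSD(E,p)` at a
rank-0 pair with `a_p = 0` and `ρ̄` onto ⇒ Kobayashi's main conjecture for BOTH signs, by Kobayashi Thm 1.2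
/ 4.1, B. D. Kim Cor 3.15, Pollack, and the locality of `Λ`):

* `kobayashiMainConjecture_of_cor54_OPEN_of_fwLocus_of_analyticRank_eq_zero` — OPEN binder + published
  facts by name + X7, `p ≠ 2`, `a_p = 0`, Surj, locus, `r_an = 0` ⇒ `∀ ε, KobayashiMainConjecture W p ε`;
* `stub_fwLocus_of_cor54_OPEN_of_analyticRank_eq_zero` — the same ⇒ `∃ ε, KobayashiLowerDivisibility W p ε`,
  i.e. LITERALLY the registered stub's statement with the extra binders `(hFW_OPEN : cor54_pPart_rankZero_OPEN)`,
  the published facts, and `W.analyticRank = 0`.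

So on its rank-0 part `stub_fwLocus` is closed MODULO one named OPEN claim (never to be fed as a theorem)
and published inputs; the rank-1 part would need Fouquet–Wan's Kato main conjecture itself (not only its
BSD corollary) composed with Kobayashi Thm 7.4 and BKO Cor A.5 — the tree has no Kato-main-conjecture
predicate for `E` at `p`, so that is not typed here. Nothing is booked; the crux stays OPEN.

References: [FouquetWan2021] Thm 5.1, Cor 5.4 (PRE); [Kobayashi2003] Thm 1.2, Thm 4.1, Conjecture (p. 2);
[BDKim2013] Cor 3.15; [Wuthrich2014] Lemma 20; [GreenbergVatsal2000] Rem 3.4; [Miller2011LMS] Def 1.1.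
-/

set_option autoImplicit false
set_option linter.dupNamespace false

noncomputable section

open scoped Classical

open WeierstrassCurve Literature.NumberTheory.EllipticCurves
  Literature.NumberTheory.EllipticCurves.ModularForms
  Literature.NumberTheory.EllipticCurves.Rank1Residual
  Literature.NumberTheory.EllipticCurves.Rank1Residual.Typed
  Literature.NumberTheory.EllipticCurves.Kobayashi2003
  Literature.NumberTheory.EllipticCurves.FouquetWan2021
  Summit.BirchSwinnertonDyer.Rank1Residual.Supersingular

namespace Summit.BirchSwinnertonDyer.BirchSwinnertonDyer.Theorems

/-- **FW locus, rank 0: the OPEN binder Fouquet–Wan Cor. 5.4 + published facts ⇒ Kobayashi's signed main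
conjecture at the pair, BOTH signs.** For a globally minimal `W/ℚ` on corner X7 at an odd prime `p`
(`hX : ClassX7 W p`), with `a_p = 0`, `ρ̄_{E,p}` onto, a prime `ℓ ≠ p` of non-split multiplicative
reduction with `p ∤ ord_ℓ(Δ_min)` (the Fouquet–Wan locus) and `ord_{s=1} L(E,s) = 0`: IF the claimed
Cor. 5.4 of Fouquet–Wan holds (`hFW_OPEN`, unrefereed), then `KobayashiMainConjecture W p ε` for every
sign `ε`, granted BY NAME modularity (`hnf`), GZK (`hGZK`), the period comparison (`h5`, `h3`), Kobayashi
2003 Thm 1.2 (`h12`) and Thm 4.1 (`h41`), B. D. Kim 2013 Cor 3.15 (`hBDK`), Wuthrich 2014 Lemma 20 (`hL20`)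
and the entireness of `L(E,s)` (`hmod'`). Proof: `BSDp W p` by
`FouquetWan2021.X7.bsdp_of_cor54_OPEN_of_analyticRank_eq_zero`, then the b2b rank-zero converse.
CONDITIONAL on an OPEN binder; closes nothing. [claim: FouquetWan2021, status: under-review]
[cite: Kobayashi2003, Thm. 1.2, Thm. 4.1 and Conjecture (p. 2)] [cite: BDKim2013, Cor. 3.15 (p. 199)] -/
theorem kobayashiMainConjecture_of_cor54_OPEN_of_fwLocus_of_analyticRank_eq_zero
    (hFW_OPEN : cor54_pPart_rankZero_OPEN)
    (hnf : exists_isNewformOf) (hGZK : rank_eq_analyticRank_of_analyticRank_le_one)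
    (h5 : realPeriodRat_eq_unit_mul_plusPeriod) (h3 : realPeriodRat_eq_unit_mul_plusPeriod_three)
    (h12 : Kobayashi2003.thm12_signedSelmerDual_finite_torsion)
    (h41 : Kobayashi2003.thm41_signedCharIdeal_divisibility)
    (hBDK : BDKim2013.cor315_signedCharValue_rankZero)
    (hL20 : Wuthrich2014.lemma20_surjective_threeAdic_of_semistable)
    (hmod' : hasEntireLFunction_rat)
    (W : WeierstrassCurve ℚ) [W.IsElliptic] [W.IsGloballyMinimal] (p : ℕ) [Fact p.Prime]
    (hp : p ≠ 2) (hX : ClassX7 W p) (hap : W.frobeniusTrace p = 0) (hs : Surj W p)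
    (hFW : ∃ (ℓ : ℕ) (_ : Fact ℓ.Prime), ℓ ≠ p ∧ W.HasMultiplicativeReductionAtPrime ℓ ∧
        ¬ W.HasSplitMultiplicativeReductionAtPrime ℓ ∧ ¬ p ∣ padicValInt ℓ W.minimalDiscriminantInt)
    (hr : W.analyticRank = 0) (ε : ℤˣ) :
    KobayashiMainConjecture W p ε :=
  kobayashiMainConjecture_of_bsdp_of_analyticRank_eq_zero W p h12 h41 hBDK h5 h3 hL20 hGZK hmod' hp
    hX.1.1 hap hs hr
    (FouquetWan2021.X7.bsdp_of_cor54_OPEN_of_analyticRank_eq_zero hFW_OPEN hnf hGZK h5 h3 W p hp hX hFW hr) ε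

/-- **`stub_fwLocus` of crux `KobayashiLowerHalfLargeImage` in ANALYTIC RANK 0, closed MODULO the OPEN
binder Fouquet–Wan Cor. 5.4.** Literally the registered stub's statement
(`p ≠ 2 → ClassX7 W p → ¬ W.HasCM → a_p = 0 → Surj W p → (∃ ℓ …) → ∃ ε, KobayashiLowerDivisibility W p ε`)
with the extra binders: the OPEN claim `hFW_OPEN`, the published facts, and `W.analyticRank = 0`. The
`¬ W.HasCM` binder of the stub is carried and unused (a supersingular non-CM hypothesis of the crux; CM is
impossible on X7 with surjective image anyway). CONDITIONAL; closes nothing; the crux stays OPEN.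
[claim: FouquetWan2021, status: under-review] [cite: Kobayashi2003, Conjecture (p. 2)] -/
theorem stub_fwLocus_of_cor54_OPEN_of_analyticRank_eq_zero
    (hFW_OPEN : cor54_pPart_rankZero_OPEN)
    (hnf : exists_isNewformOf) (hGZK : rank_eq_analyticRank_of_analyticRank_le_one)
    (h5 : realPeriodRat_eq_unit_mul_plusPeriod) (h3 : realPeriodRat_eq_unit_mul_plusPeriod_three)
    (h12 : Kobayashi2003.thm12_signedSelmerDual_finite_torsion)
    (h41 : Kobayashi2003.thm41_signedCharIdeal_divisibility)
    (hBDK : BDKim2013.cor315_signedCharValue_rankZero)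
    (hL20 : Wuthrich2014.lemma20_surjective_threeAdic_of_semistable)
    (hmod' : hasEntireLFunction_rat) :
    ∀ (W : WeierstrassCurve ℚ) [W.IsElliptic] [W.IsGloballyMinimal] (p : ℕ) [Fact p.Prime],
      p ≠ 2 → ClassX7 W p → ¬ W.HasCM → W.frobeniusTrace p = 0 → Surj W p →
      (∃ (ℓ : ℕ) (_ : Fact ℓ.Prime), ℓ ≠ p ∧ W.HasMultiplicativeReductionAtPrime ℓ ∧
          ¬ W.HasSplitMultiplicativeReductionAtPrime ℓ ∧ ¬ p ∣ padicValInt ℓ W.minimalDiscriminantInt) →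
      W.analyticRank = 0 →
      ∃ ε : ℤˣ, KobayashiLowerDivisibility W p ε := by
  intro W _ _ p _ hp hX _hcm hap hs hFW hr
  exact ⟨1, kobayashiLowerDivisibility_of_mainConjecture
    (kobayashiMainConjecture_of_cor54_OPEN_of_fwLocus_of_analyticRank_eq_zero hFW_OPEN hnf hGZK h5 h3 h12
      h41 hBDK hL20 hmod' W p hp hX hap hs hFW hr 1)⟩

end Summit.BirchSwinnertonDyer.BirchSwinnertonDyer.Theorems

end
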